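import Mathlib.Combinatorics.SimpleGraph.Coloring.Vertex
import Mathlib.Combinatorics.SimpleGraph.DegreeSum
import Mathlib.Combinatorics.SimpleGraph.Finite
import Literature.ModelTheory.FiniteModelTheory.CohomologicalConsistencyThreeColouring
import HarnessLib

/-!
# Towards Conneryd–Ghannane–Pang 2025, Theorem 6.1: proved ingredients

Sibling PROOFS file of `CohomologicalConsistencyThreeColouring.lean` (the named fact
`connerydGhannanePang2025_thm_6_1`: random `d`-regular graphs of chromatic number `> d/(4 log d)`
are accepted by cohomological `k`-consistency for `3`-colourability up to level `n·d^{-Cd}`).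
The printed proof (arXiv:2511.17272, §3–§6) rests on (A) two with-high-probability properties of
the random regular graph `𝒢_{n,d}` — sparsity (Lemma 6.4) and the chromatic-number window
(Lemma 6.2) — and (B) a deterministic core: a sparse bounded-degree graph with a proper colouring
by few colours is accepted, via the closure operator of [CdRNPR25] (Def. 6.6, Lemmas 6.7–6.8),
Alekhnovich–Razborov pseudo-reduction operators (Lemma 4.2), their integrality under lexicographic
orders (lex game, Thm. 5.2, Lemma 5.3) and the passage from an integral pseudo-reduction operator
to a self-supporting family of partial homomorphisms (Lemmas 3.1, 4.4).

This file vendors the ingredients bottom-up as PROVED theorems (no named facts), in the order of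
the source.  Landed so far:

* §1  Definition 6.3 (`IsSparse`: every vertex set `U` with `|U| ≤ s` spans at most `(1+ε)|U|`
  edges) and **Lemma 6.5** (folklore; [CdRNPR25, Lemma 2.6]): in an `(s, ε)`-sparse graph with
  `ε < 1/2` every `U` with `|U| ≤ s` induces a `3`-colourable subgraph
  (`IsSparse.exists_proper_three`, `IsSparse.colorable_induce`) — the SATISFIABILITY CONDITION of
  Lemma 4.2 for the closures of small sets (proof of Thm. 6.1, §6).  Auxiliary: the handshake
  identity for the edges inside `U` (`sum_degIn_eq`) and the minimum-degree consequence of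
  sparsity (`IsSparse.exists_degIn_le_two`).

NOT here (yet): the closure operator (Def. 6.6, Lemma 6.7), reducibility (Lemma 6.8), the
Gröbner/lex-game layer (§4–§5), Lemmas 3.1/4.4, and the probabilistic Lemmas 6.2/6.4; hence not
the discharge `connerydGhannanePang2025_thm_6_1_holds`.

## References

* [ConnerydGhannanePang2025] J. Conneryd, Y. Ghannane, S. Pang, Lower Bounds for CSP Hierarchies
  Through Ideal Reduction, arXiv:2511.17272 (SODA 2026), Def. 6.3, Lemma 6.5. READ (held text,
  chunk 21).
-/

namespace Literature.ModelTheory.FiniteModelTheory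

open Finset

namespace ConnerydGhannanePang

variable {V : Type*} [DecidableEq V] (G : SimpleGraph V) [DecidableRel G.Adj]

/-! ### §1 Sparsity (Definition 6.3) and local `3`-colourability (Lemma 6.5) -/

section Sparse

/-- The edges of `G` INSIDE the vertex set `U` (both endpoints in `U`), i.e. the edge set `E(U)`
of the induced subgraph `G[U]`, as a finset of unordered pairs. [folklore] -/
def edgesIn [Fintype V] (U : Finset V) : Finset (Sym2 V) :=
  G.edgeFinset ∩ U.sym2

/-- Membership in `edgesIn`: an edge of `G` all of whose endpoints lie in `U`. [folklore] -/
theorem mem_edgesIn [Fintype V] {U : Finset V} {e : Sym2 V} :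
    e ∈ edgesIn G U ↔ e ∈ G.edgeSet ∧ ∀ a ∈ e, a ∈ U := by
  simp only [edgesIn, Finset.mem_inter, SimpleGraph.mem_edgeFinset, Finset.mem_sym2_iff]

/-- **Sparsity** (Conneryd–Ghannane–Pang, Definition 6.3): `G` is `(s, ε)`-SPARSE if every vertex
set `U` of size at most `s` satisfies `|E(U)| ≤ (1 + ε)|U|`.
[cite: ConnerydGhannanePang2025, Def. 6.3] -/
def IsSparse [Fintype V] (s : ℕ) (ε : ℝ) : Prop :=
  ∀ U : Finset V, #U ≤ s → (#(edgesIn G U) : ℝ) ≤ (1 + ε) * #U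

/-- The degree of `v` INSIDE `U`: the number of neighbours of `v` lying in `U` (for `v ∈ U` this is
the degree of `v` in the induced subgraph `G[U]`). [folklore] -/
def degIn [Fintype V] (U : Finset V) (v : V) : ℕ :=
  #(G.neighborFinset v ∩ U)

/-- The subgraph of `G` consisting of the edges inside `U`, as a graph on the same vertex type
(vertices outside `U` are isolated). Auxiliary for the handshake identity `sum_degIn_eq`.
[folklore] -/
def insideGraph (U : Finset V) : SimpleGraph V where
  Adj v w := G.Adj v w ∧ v ∈ U ∧ w ∈ U
  symm := ⟨fun _ _ h => ⟨h.1.symm, h.2.2, h.2.1⟩⟩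
  loopless := ⟨fun _ h => G.irrefl h.1⟩

/-- Adjacency in `insideGraph` is decidable (from decidability of `G.Adj` and of membership in
`U`); needed for `edgeFinset`/`degree` of `insideGraph`. [folklore] -/
instance (U : Finset V) : DecidableRel (insideGraph G U).Adj :=
  fun v w => inferInstanceAs (Decidable (G.Adj v w ∧ v ∈ U ∧ w ∈ U))

/-- The edge set of `insideGraph U` is `E(U)`. [folklore] -/
theorem edgeFinset_insideGraph [Fintype V] (U : Finset V) :
    (insideGraph G U).edgeFinset = edgesIn G U := by
  ext e
  induction e using Sym2.ind with
  | h x y =>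
    simp only [SimpleGraph.mem_edgeFinset, SimpleGraph.mem_edgeSet, edgesIn, Finset.mem_inter,
      Finset.mk_mem_sym2_iff]
    exact Iff.rfl

/-- The degree of `v` in `insideGraph U` is its degree inside `U` if `v ∈ U` and `0` otherwise.
[folklore] -/
theorem degree_insideGraph [Fintype V] (U : Finset V) (v : V) :
    (insideGraph G U).degree v = if v ∈ U then degIn G U v else 0 := by
  rw [← SimpleGraph.card_neighborFinset_eq_degree]
  split_ifs with hv
  · unfold degIn
    congr 1
    ext w
    simp only [SimpleGraph.mem_neighborFinset, Finset.mem_inter]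
    exact ⟨fun h => ⟨h.1, h.2.2⟩, fun h => ⟨h.1, hv, h.2⟩⟩
  · rw [Finset.card_eq_zero, Finset.eq_empty_iff_forall_notMem]
    intro w hw
    rw [SimpleGraph.mem_neighborFinset] at hw
    exact hv hw.2.1

/-- HANDSHAKE INSIDE `U`: the degrees inside `U` of the vertices of `U` sum to twice the number of
edges inside `U`. [folklore] -/
theorem sum_degIn_eq [Fintype V] (U : Finset V) :
    ∑ v ∈ U, degIn G U v = 2 * #(edgesIn G U) := by
  have h := (insideGraph G U).sum_degrees_eq_twice_card_edges
  rw [edgeFinset_insideGraph] at h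
  rw [← h]
  simp_rw [degree_insideGraph]
  exact (Fintype.sum_extend_by_zero U (degIn G U)).symm

variable {G}

/-- In an `(s, ε)`-sparse graph with `ε < 1/2`, every non-empty `U` with `|U| ≤ s` contains a
vertex with at most `2` neighbours in `U` (the average degree of `G[U]` is `2|E(U)|/|U| ≤
2(1+ε) < 3`). [cite: ConnerydGhannanePang2025, proof of Lemma 6.5] -/
theorem IsSparse.exists_degIn_le_two [Fintype V] {s : ℕ} {ε : ℝ} (h : IsSparse G s ε)
    (hε : ε < 1 / 2) {U : Finset V} (hU : #U ≤ s) (hne : U.Nonempty) :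
    ∃ v ∈ U, degIn G U v ≤ 2 := by
  by_contra! hcon
  have h3 : 3 * #U ≤ 2 * #(edgesIn G U) := by
    calc 3 * #U = ∑ _v ∈ U, 3 := by rw [Finset.sum_const, smul_eq_mul, mul_comm]
      _ ≤ ∑ v ∈ U, degIn G U v := Finset.sum_le_sum fun v hv => hcon v hv
      _ = 2 * #(edgesIn G U) := sum_degIn_eq G U
  have hE := h U hU
  have hUpos : (0 : ℝ) < #U := by exact_mod_cast hne.card_pos
  have h3' : (3 : ℝ) * #U ≤ 2 * #(edgesIn G U) := by exact_mod_cast h3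
  nlinarith

/-- **Lemma 6.5** (folklore; Conneryd–Ghannane–Pang Lemma 6.5 = [CdRNPR25, Lemma 2.6]), map form:
if `G` is `(s, ε)`-sparse for some `ε < 1/2` then for every `U` with `|U| ≤ s` there is a map
`c : V → Fin 3` that is a proper `3`-colouring of `G[U]`.  Printed proof: induction on `|U|`;
a vertex `v ∈ U` of degree `≤ 2` in `G[U]` exists by sparsity, `G[U ∖ {v}]` is `3`-colourable
by induction, and at least one colour is left for `v`. [cite: ConnerydGhannanePang2025, Lemma 6.5] -/
theorem IsSparse.exists_proper_three [Fintype V] {s : ℕ} {ε : ℝ} (h : IsSparse G s ε)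
    (hε : ε < 1 / 2) (U : Finset V) (hU : #U ≤ s) :
    ∃ c : V → Fin 3, ∀ u ∈ U, ∀ v ∈ U, G.Adj u v → c u ≠ c v := by
  induction U using Finset.strongInduction with
  | H U ih =>
    rcases U.eq_empty_or_nonempty with rfl | hne
    · exact ⟨fun _ => 0, by simp⟩
    obtain ⟨u, huU, hdeg⟩ := h.exists_degIn_le_two hε hU hne
    obtain ⟨c, hc⟩ := ih (U.erase u) (Finset.erase_ssubset huU)
      ((Finset.card_erase_le).trans hU)
    -- a colour not used by `c` on the (at most two) neighbours of `u` inside `U`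
    obtain ⟨b, hb⟩ : ∃ b : Fin 3, b ∉ (G.neighborFinset u ∩ U).image c := by
      by_contra! hall
      have hsub : (Finset.univ : Finset (Fin 3)) ⊆ (G.neighborFinset u ∩ U).image c :=
        fun b _ => hall b
      have h3 := Finset.card_le_card hsub
      have h2 : #((G.neighborFinset u ∩ U).image c) ≤ 2 := Finset.card_image_le.trans hdeg
      rw [Finset.card_univ, Fintype.card_fin] at h3
      omega
    refine ⟨Function.update c u b, fun x hx y hy hxy => ?_⟩
    rcases eq_or_ne x u with rfl | hxu
    · have hyx : y ≠ x := (G.ne_of_adj hxy).symm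
      rw [Function.update_self, Function.update_of_ne hyx]
      intro hby
      exact hb (Finset.mem_image.2
        ⟨y, Finset.mem_inter.2 ⟨(G.mem_neighborFinset x y).2 hxy, hy⟩, hby.symm⟩)
    · rcases eq_or_ne y u with rfl | hyu
      · rw [Function.update_self, Function.update_of_ne hxu]
        intro hcb
        exact hb (Finset.mem_image.2
          ⟨x, Finset.mem_inter.2 ⟨(G.mem_neighborFinset y x).2 hxy.symm, hx⟩, hcb⟩)
      · rw [Function.update_of_ne hxu, Function.update_of_ne hyu]
        exact hc x (Finset.mem_erase.2 ⟨hxu, hx⟩) y (Finset.mem_erase.2 ⟨hyu, hy⟩) hxy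

/-- **Lemma 6.5** (Conneryd–Ghannane–Pang; folklore, [CdRNPR25, Lemma 2.6]), as printed: if `G`
is `(s, ε)`-sparse for some `ε < 1/2`, then for every vertex set `U` of size at most `s` the
induced subgraph `G[U]` is `3`-colourable. [cite: ConnerydGhannanePang2025, Lemma 6.5] -/
theorem IsSparse.colorable_induce [Fintype V] {s : ℕ} {ε : ℝ} (h : IsSparse G s ε)
    (hε : ε < 1 / 2) (U : Finset V) (hU : #U ≤ s) :
    (G.induce (U : Set V)).Colorable 3 := by
  obtain ⟨c, hc⟩ := h.exists_proper_three hε U hU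
  exact ⟨SimpleGraph.Coloring.mk (fun v => c v) fun {v w} hvw =>
    hc v (Finset.mem_coe.1 v.2) w (Finset.mem_coe.1 w.2) hvw⟩

end Sparse

end ConnerydGhannanePang

end Literature.ModelTheory.FiniteModelTheory
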